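import Summits.HodgeConjecture.HodgeConjecture.Theorems.BoundaryReadoutPullbackAlgebraicConstantLift
import Literature.AlgebraicGeometry.Resolution.SliceCartierDivisor
import Literature.AlgebraicGeometry.Resolution.ExceptionalDivisorLocallyTrivial
import Literature.AlgebraicGeometry.Resolution.BlowupSmoothProjective
import Literature.AlgebraicGeometry.Motives.ProjectiveSpaceFieldPoints
import Literature.AlgebraicGeometry.Motives.AlgebraicEquivalencePushforwardFacts
import Literature.AlgebraicGeometry.Motives.AbelianVarietyQuotientPoints
import Literature.AlgebraicGeometry.HodgeTheory.HolomorphicBundleChernCharacterProjectiveSpace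
import HarnessLib

/-!
# Crux `PullbackAlgebraic` (stmt-HodgeConjecture-1071): the CONSTANT-LIFT DEFORMATION DATUM, constructed
# (deformation to the normal cone: `M = Bl_{X × {t₁}}(Y × ℙ¹)`), modulo the structure of the exceptional divisor

Work item stmt-HodgeConjecture-1071. The landed composition
`Theorems/BoundaryReadoutPullbackAlgebraicConstantLift` proves the crux from two hypotheses: the
constant-lift deformation datum `hD` and the section pull-back `hSec`. This file CONSTRUCTS the datum
(Fulton 1998, §5.1): `T = ℙ¹_ℂ` with `t₀ = (1:0)`, `t₁ = (0:1)` (`ProjectiveSpace.pointOfVec`); the centre `X × {t₁} ↪ Y ⊗ T` (a closed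
immersion from a regular scheme); `M` = a blowing up of `Y ⊗ T` along it, smooth projective of dimension
`n + r + 1` (`exists_isBlowup_ker_isSmoothProjective`); `φ = β ≫ pr_Y`; the strict transform
`J : X ⊗ T → M` = the lift of `i × 1_T` through the blowing up, which exists because the centre pulls back
to the effective Cartier divisor `X × {t₁} ⊂ X ⊗ T` (`isEffectiveCartier_ker_sliceAt`); the exceptional
divisor `E = M ×_{Y ⊗ T} X` with `k = pr₁`, `q = pr₂` and the section `s = (ι_{t₁} ≫ J, 𝟙)`; the slice at
`t₀` misses `k(E)` (it lies over `t₀ ≠ t₁`); and `Z̄ Z = closure (φ⁻¹ Z ∖ k(E))`.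

What is NOT constructed here and enters as hypotheses: the exceptional divisor `E → X` is a smooth
projective variety of dimension `n + r` and is Zariski-locally over `X` isomorphic to `U × ℙʳ → U`
(Hartshorne II 8.24 (b) — the named fact `Hartshorne1977_exceptionalDivisor_locallyTrivial` and its
smooth-projectivity companion `hE`), and the codimension bookkeeping of `Z̄` (hypothesis `hZ`).

## References

* [Fulton1998] W. Fulton, Intersection Theory, 2nd ed. (1998), §5.1, App. B.6.
* [Hartshorne1977] R. Hartshorne, Algebraic Geometry (1977), II Thm. 8.24.
-/

noncomputable section

-- every declaration of this problem lives in `Summit.HodgeConjecture.HodgeConjecture.…` (summit = sub-problem)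
set_option linter.dupNamespace false

namespace Summit.HodgeConjecture.HodgeConjecture.Theorems

open CategoryTheory CategoryTheory.Limits AlgebraicGeometry MonoidalCategory CartesianMonoidalCategory
open Literature.AlgebraicGeometry Literature.AlgebraicGeometry.Motives Literature.AlgebraicGeometry.Resolution
open Literature.AlgebraicGeometry.HodgeTheory

/-! ### The parameter curve `ℙ¹` and its two points -/

/-- `(1 : 0) ≠ 0` in `ℂ²`. [folklore] -/
theorem vec10_ne_zero : (![1, 0] : Fin 2 → ℂ) ≠ 0 := by
  intro h; have := congrFun h 0; simp at this

/-- `(0 : 1) ≠ 0` in `ℂ²`. [folklore] -/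
theorem vec01_ne_zero : (![0, 1] : Fin 2 → ℂ) ≠ 0 := by
  intro h; have := congrFun h 1; simp at this

/-- `(1 : 0) ≠ (0 : 1)` as points of `ℙ¹_ℂ` (`(0:1) ∈ D₊(x₁) ∌ (1:0)`). [folklore] -/
theorem pt_pointOfVec10_ne_pt_pointOfVec01 :
    (ProjectiveSpace.pointOfVec ℂ (![1, 0] : Fin 2 → ℂ) vec10_ne_zero).pt ≠
      (ProjectiveSpace.pointOfVec ℂ (![0, 1] : Fin 2 → ℂ) vec01_ne_zero).pt := by
  intro h
  have h1 := (ProjectiveSpace.pt_pointOfVec_mem_basicOpen_X_iff (k := ℂ)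
    (![0, 1] : Fin 2 → ℂ) vec01_ne_zero 1).2 (by simp)
  have h0 : (ProjectiveSpace.pointOfVec ℂ (![1, 0] : Fin 2 → ℂ) vec10_ne_zero).pt ∉ _ := fun h' ↦
    (ProjectiveSpace.pt_pointOfVec_mem_basicOpen_X_iff (k := ℂ)
      (![1, 0] : Fin 2 → ℂ) vec10_ne_zero 1).1 h' (by simp)
  exact h0 (h ▸ h1)

/-- The constant map `X → Spec ℂ →t T` takes the value `t.pt` everywhere. [folklore] -/
theorem toSpecOver_comp_left_apply' {X T : SchemeOver ℂ} (t : AlgPoints T ℂ) (x : X.left) :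
    (toSpecOver X ≫ t).left x = t.pt := by
  haveI : Unique ↥(specOver ℂ ℂ).left := inferInstanceAs (Unique (PrimeSpectrum ℂ))
  change t.left (X.hom x) = t.left _
  congr 1
  exact Subsingleton.elim _ _

/-- `pr_T (ι_t ≫ (f × 1_T)) (x) = t`. [folklore] -/
theorem snd_sliceAt_whiskerRight_apply {X Y T : SchemeOver ℂ} (f : X ⟶ Y) (t : AlgPoints T ℂ)
    (x : X.left) : (snd Y T).left ((f ▷ T).left ((sliceAt X t).left x)) = t.pt := by
  rw [← Scheme.Hom.comp_apply, ← Scheme.Hom.comp_apply, ← Over.comp_left, ← Over.comp_left,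
    whiskerRight_snd, sliceAt_snd]
  exact toSpecOver_comp_left_apply' t x

/-! ### The deformation space -/

section Construction

variable {n r : ℕ} {X Y : SchemeOver ℂ}

/-- A smooth projective complex variety is a regular scheme. [cite: Hartshorne1977, II Thm. 8.24 (a)] -/
theorem isRegular_of_isSmoothProjective (hX : IsSmoothProjective n X) : Scheme.IsRegular X.left := by
  haveI := hX.smoothOfRelativeDimension
  exact fun x ↦ isRegularLocalRing_stalk_of_smoothOfRelativeDimension (f := X.hom) (n := n) x

/-- **The constant-lift deformation datum, constructed modulo the structure of the exceptional divisor
and the codimension bookkeeping of the closures** (deformation to the normal cone, Fulton 1998 §5.1).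
Hypotheses: `hα` — the exceptional divisor of the blowing up of a smooth projective variety along a
smooth closed subvariety is Zariski-locally over the centre a product with `ℙʳ` (Hartshorne II 8.24 (b),
the named fact `Hartshorne1977_exceptionalDivisor_locallyTrivial`); `hE` — it is a smooth projective
variety of dimension `dim(centre) + r`; `hZ` — codimension bookkeeping: for the blowing up `β` of
`Y ⊗ T` along `X × {t₁}` with exceptional divisor `k : E → M` and a closed `Z ⊆ Y` of codimension `≥ p`,
the closure of `β⁻¹(Z × T) ∖ k(E)` has codimension `≥ p` in `M` and meets `E` in codimension `≥ p`.
[cite: Fulton1998, §5.1 and App. B.6] [cite: Hartshorne1977, II Thm. 8.24] -/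
theorem constantLiftDatum_of_exceptionalDivisor
    (hα : Hartshorne1977_exceptionalDivisor_locallyTrivial.{0})
    (hE : ∀ ⦃m r : ℕ⦄ ⦃V Z B : SchemeOver ℂ⦄ (i : Z ⟶ V) (β : B ⟶ V),
      IsSmoothProjective (m + r + 1) V → IsSmoothProjective m Z → IsClosedImmersion i.left →
      IsBlowup β.left i.left.ker →
      IsSmoothProjective (m + r) (Over.mk (pullback.snd β.left i.left ≫ Z.hom) : SchemeOver ℂ))
    (hZ : ∀ ⦃m r : ℕ⦄ ⦃Y X B : SchemeOver ℂ⦄ (T : SchemeOver ℂ) (ic : X ⟶ Y ⊗ T) (β : B ⟶ Y ⊗ T),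
      IsSmoothProjective (m + r) Y → IsSmoothProjective 1 T → IsSmoothProjective m X →
      IsClosedImmersion ic.left → IsBlowup β.left ic.left.ker →
      IsSmoothProjective (m + r + 1) B → IsIso (β.left ∣_ centreCompl ic.left.ker) →
      IsSmoothProjective (m + r) (Over.mk (pullback.snd β.left ic.left ≫ X.hom) : SchemeOver ℂ) →
      ∀ (p : ℕ) (Z : Set Y.left), IsClosed Z → (∀ z ∈ Z, (p : ℕ∞) ≤ Order.coheight z) →
        (∀ w ∈ closure ((β.left ≫ (fst Y T).left) ⁻¹' Z \ Set.range (pullback.fst β.left ic.left)),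
          (p : ℕ∞) ≤ Order.coheight w) ∧
        ∀ w ∈ (pullback.fst β.left ic.left) ⁻¹'
            closure ((β.left ≫ (fst Y T).left) ⁻¹' Z \ Set.range (pullback.fst β.left ic.left)),
          (p : ℕ∞) ≤ Order.coheight w)
    (i : X ⟶ Y) (hX : IsSmoothProjective n X) (hY : IsSmoothProjective (n + r) Y)
    (hi : IsClosedImmersion i.left) (_hr : 1 ≤ r) :
    ∃ (T : SchemeOver ℂ) (t₀ t₁ : AlgPoints T ℂ) (M E : SchemeOver ℂ) (φ : M ⟶ Y)
      (J : X ⊗ T ⟶ M) (k : E ⟶ M) (q : E ⟶ X) (s : X ⟶ E) (Zbar : Set Y.left → Set M.left),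
      IsSmoothProjective 1 T ∧ IsSmoothProjective (n + r + 1) M ∧ IsSmoothProjective (n + r) E ∧
      Motives.sliceAt X t₀ ≫ J ≫ φ = i ∧ s ≫ k = Motives.sliceAt X t₁ ≫ J ∧ s ≫ q = 𝟙 X ∧
      Disjoint (Set.range (Motives.sliceAt X t₀ ≫ J).left.base) (Set.range k.left.base) ∧
      (∀ x : X.left, ∃ U : X.left.Opens, x ∈ U ∧
        ∃ ψ : (Over.mk ((q.left ⁻¹ᵁ U).ι ≫ E.hom) : SchemeOver ℂ) ≅
            (Over.mk (U.ι ≫ X.hom) : SchemeOver ℂ) ⊗ Motives.projectiveSpace r ℂ,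
          ψ.hom.left ≫ (fst (Over.mk (U.ι ≫ X.hom) : SchemeOver ℂ)
            (Motives.projectiveSpace r ℂ)).left ≫ U.ι = (q.left ⁻¹ᵁ U).ι ≫ q.left) ∧
      ∀ (p : ℕ) (Z : Set Y.left), IsClosed Z → (∀ z ∈ Z, (p : ℕ∞) ≤ Order.coheight z) →
        IsClosed (Zbar Z) ∧ (∀ w ∈ Zbar Z, (p : ℕ∞) ≤ Order.coheight w) ∧
        φ.left.base ⁻¹' Z ⊆ Zbar Z ∪ Set.range k.left.base ∧
        ∀ w ∈ k.left.base ⁻¹' Zbar Z, (p : ℕ∞) ≤ Order.coheight w := by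
  -- the curve and its two points
  let T : SchemeOver ℂ := projectiveSpace 1 ℂ
  have hT : IsSmoothProjective 1 T := isSmoothProjective_projectiveSpace' 1
  haveI := hT.smoothOfRelativeDimension
  haveI : Smooth T.hom := SmoothOfRelativeDimension.smooth (n := 1) (f := T.hom)
  haveI : LocallyOfFiniteType T.hom := inferInstance
  let t₀ : AlgPoints T ℂ := ProjectiveSpace.pointOfVec ℂ (![1, 0] : Fin 2 → ℂ) vec10_ne_zero
  let t₁ : AlgPoints T ℂ := ProjectiveSpace.pointOfVec ℂ (![0, 1] : Fin 2 → ℂ) vec01_ne_zero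
  -- the ambient space and the centre
  have hYT : IsSmoothProjective (n + r + 1) (Y ⊗ T) := IsSmoothProjective.tensor_holds hY hT
  haveI : IsClosedImmersion i.left := hi
  let icO : X ⟶ Y ⊗ T := sliceAt X t₁ ≫ i ▷ T
  have hicO : icO = i ≫ sliceAt Y t₁ := sliceAt_whiskerRight i t₁
  haveI hic : IsClosedImmersion icO.left := by
    rw [hicO, Over.comp_left]
    haveI := isClosedImmersion_sliceAt_left (X := Y) t₁
    infer_instance
  -- the centre is not everything: the slice at `t₀` misses it
  haveI : Nonempty X.left := by
    haveI := IsSmoothProjective.isIntegral_holds hX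
    infer_instance
  have hne : Set.range icO.left ≠ Set.univ := by
    intro h
    obtain ⟨x⟩ := ‹Nonempty X.left›
    have hmem : (i ▷ T).left ((sliceAt X t₀).left x) ∈ Set.range icO.left := h ▸ Set.mem_univ _
    obtain ⟨x', hx'⟩ := hmem
    have h1 : (snd Y T).left (icO.left x') = t₁.pt := by
      change (snd Y T).left ((sliceAt X t₁ ≫ i ▷ T).left x') = t₁.pt
      rw [Over.comp_left, Scheme.Hom.comp_apply]
      exact snd_sliceAt_whiskerRight_apply i t₁ x'
    have h0 : (snd Y T).left ((i ▷ T).left ((sliceAt X t₀).left x)) = t₀.pt :=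
      snd_sliceAt_whiskerRight_apply i t₀ x
    rw [hx'] at h1
    exact pt_pointOfVec10_ne_pt_pointOfVec01 (h0.symm.trans h1)
  -- the blowing up
  obtain ⟨M, β, hβ, hM, -, hiso⟩ :=
    exists_isBlowup_ker_isSmoothProjective hYT icO.left (isRegular_of_isSmoothProjective hX) hne
  -- the strict transform of `X ⊗ T`: the centre pulls back to the Cartier divisor `X × {t₁}`
  haveI hiT : IsClosedImmersion (i ▷ T).left :=
    AbelianVariety.whiskerRight_left_mem (W := @IsClosedImmersion) i hi
  have hcart : IsEffectiveCartier (icO.left.ker.comap (i ▷ T).left) := by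
    have e1 : icO.left = (sliceAt X t₁).left ≫ (i ▷ T).left := rfl
    rw [← Scheme.IdealSheafData.ker_fst_of_isClosedImmersion]
    have hfst : pullback.fst (i ▷ T).left icO.left =
        pullback.snd (i ▷ T).left icO.left ≫ (sliceAt X t₁).left := by
      rw [← cancel_mono (i ▷ T).left, Category.assoc, ← e1]
      exact pullback.condition
    haveI : IsIso (pullback.snd (i ▷ T).left icO.left) := by
      rw [e1]; infer_instance
    rw [hfst, Scheme.Hom.ker_comp_of_isIso]
    exact isEffectiveCartier_ker_sliceAt (X := X) hT t₁
  let J : X ⊗ T ⟶ M := Over.homMk (hβ.lift (i ▷ T).left hcart) (by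
    rw [← Over.w β, ← Category.assoc, hβ.lift_comp, Over.w])
  have hJβ : J ≫ β = i ▷ T := by
    refine Over.OverMorphism.ext ?_
    rw [Over.comp_left]
    exact hβ.lift_comp (i ▷ T).left hcart
  -- the exceptional divisor
  let E : SchemeOver ℂ := Over.mk (pullback.snd β.left icO.left ≫ X.hom)
  let k : E ⟶ M := Over.homMk (pullback.fst β.left icO.left) (by
    change pullback.fst β.left icO.left ≫ M.hom = pullback.snd β.left icO.left ≫ X.hom
    rw [← Over.w β, pullback.condition_assoc, Over.w icO])
  let q : E ⟶ X := Over.homMk (pullback.snd β.left icO.left) rfl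
  have hEsp : IsSmoothProjective (n + r) E := hE icO β hYT hX hic hβ
  -- the section
  have hsJ : ((sliceAt X t₁).left ≫ J.left) ≫ β.left = 𝟙 X.left ≫ icO.left := by
    rw [Category.id_comp, Category.assoc, ← Over.comp_left, hJβ, ← Over.comp_left]
  let s : X ⟶ E := Over.homMk (pullback.lift ((sliceAt X t₁).left ≫ J.left) (𝟙 X.left) hsJ) (by
    change pullback.lift _ _ hsJ ≫ pullback.snd β.left icO.left ≫ X.hom = X.hom
    rw [pullback.lift_snd_assoc, Category.id_comp])
  have hsk : s ≫ k = sliceAt X t₁ ≫ J := by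
    refine Over.OverMorphism.ext ?_
    rw [Over.comp_left, Over.comp_left]
    exact pullback.lift_fst _ _ _
  have hsq : s ≫ q = 𝟙 X := by
    refine Over.OverMorphism.ext ?_
    rw [Over.comp_left]
    exact pullback.lift_snd _ _ _
  -- the closures
  let Zbar : Set Y.left → Set M.left := fun Z ↦
    closure ((β.left ≫ (fst Y T).left) ⁻¹' Z \ Set.range (pullback.fst β.left icO.left))
  refine ⟨T, t₀, t₁, M, E, β ≫ fst Y T, J, k, q, s, Zbar, hT, hM, hEsp, ?_, hsk, hsq, ?_, ?_, ?_⟩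
  · -- `ι_{t₀} ≫ J ≫ φ = i`
    rw [← Category.assoc J β (fst Y T), hJβ, whiskerRight_fst, ← Category.assoc, sliceAt_fst,
      Category.id_comp]
  · -- the slice at `t₀` misses `k(E)`: they lie over `t₀ ≠ t₁`
    refine Set.disjoint_left.2 ?_
    rintro _ ⟨x, rfl⟩ ⟨e, he⟩
    apply pt_pointOfVec10_ne_pt_pointOfVec01
    have h0 : (snd Y T).left (β.left ((sliceAt X t₀ ≫ J).left x)) = t₀.pt := by
      have e1 : (sliceAt X t₀ ≫ J).left x = J.left ((sliceAt X t₀).left x) := by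
        rw [Over.comp_left]; rfl
      rw [e1, ← Scheme.Hom.comp_apply J.left β.left, ← Over.comp_left, hJβ]
      exact snd_sliceAt_whiskerRight_apply i t₀ x
    have hc : ∀ e' : ↥(pullback β.left icO.left),
        β.left (pullback.fst β.left icO.left e') = icO.left (pullback.snd β.left icO.left e') :=
      fun e' ↦ by rw [← Scheme.Hom.comp_apply, pullback.condition, Scheme.Hom.comp_apply]
    have h1 : (snd Y T).left (β.left (k.left e)) = t₁.pt := by
      change (snd Y T).left (β.left (pullback.fst β.left icO.left e)) = t₁.pt
      rw [hc e]
      exact snd_sliceAt_whiskerRight_apply i t₁ _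
    change k.left e = (sliceAt X t₀ ≫ J).left x at he
    rw [← he] at h0
    exact h0.symm.trans h1
  · -- Zariski-local triviality of `q : E → X` (the named fact)
    exact hα ℂ icO β hYT hX hic hβ
  · -- the closures: closed, `φ⁻¹ Z ⊆ Z̄ ∪ k(E)`, and the codimension bookkeeping
    intro p Z hZc hZp
    obtain ⟨h1, h2⟩ := hZ T icO β hY hT hX hic hβ hM hiso hEsp p Z hZc hZp
    refine ⟨isClosed_closure, h1, fun w hw ↦ ?_, h2⟩
    by_cases hwE : w ∈ Set.range (pullback.fst β.left icO.left)
    · exact Or.inr hwE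
    · exact Or.inl (subset_closure ⟨hw, hwE⟩)

end Construction

/-! ### The crux modulo the exceptional-divisor structure, the bookkeeping and the section pull-back -/

/-- **The crux `PullbackAlgebraic` (primary decl) from: the Zariski-local triviality of exceptional
divisors (named fact, Hartshorne II 8.24 (b)), their smooth projectivity, the codimension bookkeeping
of the closures, and the section pull-back** — the constant-lift composition
`PullbackAlgebraic_of_constantLift` fed with the constructed datum.
[cite: Fulton1998, §5.1, §6.2 and Cor. 19.2 (b)] [cite: Hartshorne1977, II Thm. 8.24] -/
theorem PullbackAlgebraic_of_exceptionalDivisor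
    (hα : Hartshorne1977_exceptionalDivisor_locallyTrivial.{0})
    (hE : ∀ ⦃m r : ℕ⦄ ⦃V Z B : SchemeOver ℂ⦄ (i : Z ⟶ V) (β : B ⟶ V),
      IsSmoothProjective (m + r + 1) V → IsSmoothProjective m Z → IsClosedImmersion i.left →
      IsBlowup β.left i.left.ker →
      IsSmoothProjective (m + r) (Over.mk (pullback.snd β.left i.left ≫ Z.hom) : SchemeOver ℂ))
    (hZ : ∀ ⦃m r : ℕ⦄ ⦃Y X B : SchemeOver ℂ⦄ (T : SchemeOver ℂ) (ic : X ⟶ Y ⊗ T) (β : B ⟶ Y ⊗ T),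
      IsSmoothProjective (m + r) Y → IsSmoothProjective 1 T → IsSmoothProjective m X →
      IsClosedImmersion ic.left → IsBlowup β.left ic.left.ker →
      IsSmoothProjective (m + r + 1) B → IsIso (β.left ∣_ centreCompl ic.left.ker) →
      IsSmoothProjective (m + r) (Over.mk (pullback.snd β.left ic.left ≫ X.hom) : SchemeOver ℂ) →
      ∀ (p : ℕ) (Z : Set Y.left), IsClosed Z → (∀ z ∈ Z, (p : ℕ∞) ≤ Order.coheight z) →
        (∀ w ∈ closure ((β.left ≫ (fst Y T).left) ⁻¹' Z \ Set.range (pullback.fst β.left ic.left)),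
          (p : ℕ∞) ≤ Order.coheight w) ∧
        ∀ w ∈ (pullback.fst β.left ic.left) ⁻¹'
            closure ((β.left ≫ (fst Y T).left) ⁻¹' Z \ Set.range (pullback.fst β.left ic.left)),
          (p : ℕ∞) ≤ Order.coheight w)
    (hSec : ∀ ⦃n r : ℕ⦄ ⦃X E : SchemeOver ℂ⦄ (q : E ⟶ X) (s : X ⟶ E), IsSmoothProjective n X →
      IsSmoothProjective (n + r) E → s ≫ q = 𝟙 X →
      (∀ x : X.left, ∃ U : X.left.Opens, x ∈ U ∧
        ∃ ψ : (Over.mk ((q.left ⁻¹ᵁ U).ι ≫ E.hom) : SchemeOver ℂ) ≅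
            (Over.mk (U.ι ≫ X.hom) : SchemeOver ℂ) ⊗ Motives.projectiveSpace r ℂ,
          ψ.hom.left ≫ (fst (Over.mk (U.ι ≫ X.hom) : SchemeOver ℂ)
            (Motives.projectiveSpace r ℂ)).left ≫ U.ι = (q.left ⁻¹ᵁ U).ι ≫ q.left) →
      ∀ (p : ℕ), ∀ y ∈ algebraicClasses E p,
        complexBetti.map s (2 * p) y ∈ algebraicClasses X p) :
    Summit.HodgeConjecture.HodgeConjecture.Theses.QbarEnvelope.PullbackAlgebraic :=
  PullbackAlgebraic_of_constantLift
    (fun _ _ _ _ i hX hY hi hr ↦ constantLiftDatum_of_exceptionalDivisor hα hE hZ i hX hY hi hr) hSec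

/-- The same for the `BoundaryReadout` decl of the crux. [cite: Fulton1998, §19.2 Cor. 19.2 (b)] -/
theorem boundaryReadout_pullbackAlgebraic_of_exceptionalDivisor
    (hα : Hartshorne1977_exceptionalDivisor_locallyTrivial.{0})
    (hE : ∀ ⦃m r : ℕ⦄ ⦃V Z B : SchemeOver ℂ⦄ (i : Z ⟶ V) (β : B ⟶ V),
      IsSmoothProjective (m + r + 1) V → IsSmoothProjective m Z → IsClosedImmersion i.left →
      IsBlowup β.left i.left.ker →
      IsSmoothProjective (m + r) (Over.mk (pullback.snd β.left i.left ≫ Z.hom) : SchemeOver ℂ))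
    (hZ : ∀ ⦃m r : ℕ⦄ ⦃Y X B : SchemeOver ℂ⦄ (T : SchemeOver ℂ) (ic : X ⟶ Y ⊗ T) (β : B ⟶ Y ⊗ T),
      IsSmoothProjective (m + r) Y → IsSmoothProjective 1 T → IsSmoothProjective m X →
      IsClosedImmersion ic.left → IsBlowup β.left ic.left.ker →
      IsSmoothProjective (m + r + 1) B → IsIso (β.left ∣_ centreCompl ic.left.ker) →
      IsSmoothProjective (m + r) (Over.mk (pullback.snd β.left ic.left ≫ X.hom) : SchemeOver ℂ) →
      ∀ (p : ℕ) (Z : Set Y.left), IsClosed Z → (∀ z ∈ Z, (p : ℕ∞) ≤ Order.coheight z) →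
        (∀ w ∈ closure ((β.left ≫ (fst Y T).left) ⁻¹' Z \ Set.range (pullback.fst β.left ic.left)),
          (p : ℕ∞) ≤ Order.coheight w) ∧
        ∀ w ∈ (pullback.fst β.left ic.left) ⁻¹'
            closure ((β.left ≫ (fst Y T).left) ⁻¹' Z \ Set.range (pullback.fst β.left ic.left)),
          (p : ℕ∞) ≤ Order.coheight w)
    (hSec : ∀ ⦃n r : ℕ⦄ ⦃X E : SchemeOver ℂ⦄ (q : E ⟶ X) (s : X ⟶ E), IsSmoothProjective n X →
      IsSmoothProjective (n + r) E → s ≫ q = 𝟙 X →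
      (∀ x : X.left, ∃ U : X.left.Opens, x ∈ U ∧
        ∃ ψ : (Over.mk ((q.left ⁻¹ᵁ U).ι ≫ E.hom) : SchemeOver ℂ) ≅
            (Over.mk (U.ι ≫ X.hom) : SchemeOver ℂ) ⊗ Motives.projectiveSpace r ℂ,
          ψ.hom.left ≫ (fst (Over.mk (U.ι ≫ X.hom) : SchemeOver ℂ)
            (Motives.projectiveSpace r ℂ)).left ≫ U.ι = (q.left ⁻¹ᵁ U).ι ≫ q.left) →
      ∀ (p : ℕ), ∀ y ∈ algebraicClasses E p,
        complexBetti.map s (2 * p) y ∈ algebraicClasses X p) :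
    Summit.HodgeConjecture.HodgeConjecture.Theses.BoundaryReadout.PullbackAlgebraic :=
  fun _ _ hX _ _ hW ι p c' hc' ↦ PullbackAlgebraic_of_exceptionalDivisor hα hE hZ hSec hX hW ι p c' hc'

end Summit.HodgeConjecture.HodgeConjecture.Theorems

end
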